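import Literature.Barriers.NavierStokesRegularity.ComplexNavierStokesBlowupSeriesEnergy
import HarnessLib

/-!
# Li–Sinai complex Navier–Stokes blow-up: the first singular time of the series solution

Fifth file of the barrier entry `ComplexNavierStokesBlowup` (D-0021), companion of
`ComplexNavierStokesBlowupSeries.lean` (the power series (3) of D. Li, Ya. G. Sinai, *Blow ups
of complex solutions of the 3D Navier–Stokes system and renormalization group method*, J. Eur.
Math. Soc. 10 (2008) 267–313, §2, proved there to solve (1) at all times) and of
`ComplexNavierStokesBlowupSeriesEnergy.lean` (finite energy of the series for small times, and
the named fact `LiSinaiSeriesEnergyInfinite`: infinite energy at SOME time, the first inference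
of §10 p. 312 from Theorem 1 p. 311).

This file records, by PROVED theorems only, what separates the energy-profile fact
`LiSinaiSeriesEnergyBlowup` (finite energy on `[0, t)`, infinite at `t` — the printed sentence
"for `t' < t` both the energy and the enstrophy are finite while at `t' = t` they both become
infinite", §1 p. 268 and §10 p. 312) from `LiSinaiSeriesEnergyInfinite`, for the SAME explicit
object `LiSinai.seriesSolution v₀`:

* `LiSinai.exists_firstSingularTime`: if the series solution of an admissible datum has
  infinite energy at some time `t ≥ 0`, then the first singular time
  `t₁ = inf {τ ≥ 0 : E(τ) = ∞}` satisfies `0 < t₁ ≤ t` (positivity by the small-time theorem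
  `LiSinai.seriesSolution_energy_lt_top`), the energy is finite on `[0, t₁)`, and EITHER
  `E(t₁) = ∞` OR `E(t₁) < ∞` with infinite-energy times accumulating at `t₁` from the right;
* `LiSinaiSeriesEnergyInfinite.seriesEnergyBlowup_or_rightAccumulation`: hence the
  infinite-energy fact gives the energy-profile fact `LiSinaiSeriesEnergyBlowup` outright UNLESS
  the first singular time of the witness is not attained (right accumulation) — the series-level
  form of `LiSinaiCriticalEnergyBlowupNarrow.literal_or_rightAccumulation`, now keeping the
  solution explicit so that the first disjunct is literally `LiSinaiSeriesEnergyBlowup`;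
* `LiSinaiSeriesEnergyBlowup_iff_firstSingularTime_attained`: `LiSinaiSeriesEnergyBlowup` holds
  iff some admissible datum has a singular time AND its first singular time is attained.
* (appended) `LiSinai.energy_lt_top_of_mode_geometric`: geometric decay of the modes at a time
  `τ`, `‖mode v₀ p (τ, ·)‖_∞ ≤ C q^p` with `0 ≤ q < 1`, gives finite energy at `τ` (supports in
  `B(0, p|R|)`, `∫ |v|² ≤ ‖v‖_∞ ‖v‖₁`, `Σ p³ q^p < ∞`) — the mechanism of the informal "for
  `t' < t` … finite" of §10 p. 312 — and `LiSinaiSeriesEnergyBlowup.of_infinite_of_modeDecay`: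
  infinite energy at `t` plus such decay at every `τ < t` gives `LiSinaiSeriesEnergyBlowup`.

So the content of `LiSinaiSeriesEnergyBlowup` beyond Theorem 1 and the first line of §10 is
exactly the ATTAINMENT of the first singular time, which in print is the informal second
paragraph of §10 ("For `p ≫ O(1/Δt)` the product `A_cr Λ(t')^p` tends exponentially to zero …
Therefore for `t' < t` both the energy and the enstrophy are finite"), argued from a
representation of `g_p(·, t')` for the `t`-critical datum that Theorem 1 (parameters `b(s)`
depending on `s`) does not state — see the audit in `ComplexNavierStokesBlowupProofs.lean`.
Nothing here is specific to the renormalisation-group analysis; no lower bound on the modes is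
proved.

## References

* D. Li, Ya. G. Sinai, J. Eur. Math. Soc. 10 (2008) 267–313: §1 p. 268, §2 p. 270, Thm. 1
  p. 311, §10 p. 312. [`LiSinai2008`]
-/

noncomputable section

open MeasureTheory Set Filter Topology
open scoped ENNReal InnerProductSpace RealInnerProductSpace

namespace Literature.Barriers.NavierStokesRegularity

namespace LiSinai

/-- **The first singular time of the series solution.** Let `v₀` be measurable, bounded, and
vanish off `{a ≤ k₃, |k| ≤ R}` with `a > 0`, and suppose the energy
`E(τ) = ∫ |seriesSolution v₀ (k, τ)|² dk` is infinite at some `t ≥ 0`. Then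
`t₁ = inf {τ ≥ 0 : E(τ) = ∞}` satisfies `0 < t₁ ≤ t` — positivity because the energy is finite
on an initial interval `[0, t₀)` (`seriesSolution_energy_lt_top`) — the energy is finite on
`[0, t₁)`, and either `E(t₁) = ∞`, or `E(t₁) < ∞` and every interval `(t₁, t₁ + η)` contains a
time of infinite energy. Pure real analysis on top of the small-time theorem. [folklore] -/
theorem exists_firstSingularTime {v₀ : EuclideanSpace ℝ (Fin 3) → EuclideanSpace ℝ (Fin 3)}
    {a R M₀ : ℝ} (ha : 0 < a) (hv₀m : Measurable v₀) (hv₀ : ∀ k, v₀ k ≠ 0 → a ≤ k 2 ∧ ‖k‖ ≤ R)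
    (hM₀ : ∀ k, ‖v₀ k‖ ≤ M₀)
    {t : ℝ} (ht : 0 ≤ t) (hinf : ∫⁻ k, ‖seriesSolution v₀ t k‖ₑ ^ 2 = ∞) :
    ∃ t₁ : ℝ, 0 < t₁ ∧ t₁ ≤ t ∧
      t₁ = sInf {τ : ℝ | 0 ≤ τ ∧ ∫⁻ k, ‖seriesSolution v₀ τ k‖ₑ ^ 2 = ∞} ∧
      (∀ τ ∈ Ico 0 t₁, ∫⁻ k, ‖seriesSolution v₀ τ k‖ₑ ^ 2 < ∞) ∧
      (∫⁻ k, ‖seriesSolution v₀ t₁ k‖ₑ ^ 2 = ∞ ∨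
        (∫⁻ k, ‖seriesSolution v₀ t₁ k‖ₑ ^ 2 < ∞ ∧
          ∀ η : ℝ, 0 < η → ∃ τ ∈ Ioo t₁ (t₁ + η),
            ∫⁻ k, ‖seriesSolution v₀ τ k‖ₑ ^ 2 = ∞)) := by
  classical
  obtain ⟨t₀, ht₀, hfin⟩ := seriesSolution_energy_lt_top ha hv₀m hv₀ hM₀
  set S : Set ℝ := {τ : ℝ | 0 ≤ τ ∧ ∫⁻ k, ‖seriesSolution v₀ τ k‖ₑ ^ 2 = ∞} with hS
  have htS : t ∈ S := ⟨ht, hinf⟩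
  have hSne : S.Nonempty := ⟨t, htS⟩
  have hSbdd : BddBelow S := ⟨0, fun τ hτ => hτ.1⟩
  -- every singular time is `≥ t₀`
  have hSt₀ : ∀ τ ∈ S, t₀ ≤ τ := by
    intro τ hτ
    by_contra hlt
    exact (hfin τ ⟨hτ.1, not_le.1 hlt⟩).ne hτ.2
  have ht₀t₁ : t₀ ≤ sInf S := le_csInf hSne hSt₀
  have ht₁t : sInf S ≤ t := csInf_le hSbdd htS
  have hfin' : ∀ τ ∈ Ico 0 (sInf S), ∫⁻ k, ‖seriesSolution v₀ τ k‖ₑ ^ 2 < ∞ := by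
    intro τ hτ
    have hnot : τ ∉ S := notMem_of_lt_csInf hτ.2 hSbdd
    exact lt_top_iff_ne_top.2 fun h' => hnot ⟨hτ.1, h'⟩
  refine ⟨sInf S, ht₀.trans_le ht₀t₁, ht₁t, rfl, hfin', ?_⟩
  by_cases hcase : ∫⁻ k, ‖seriesSolution v₀ (sInf S) k‖ₑ ^ 2 = ∞
  · exact Or.inl hcase
  · refine Or.inr ⟨lt_top_iff_ne_top.2 hcase, fun η hη => ?_⟩
    obtain ⟨τ, hτS, hτlt⟩ := exists_lt_of_csInf_lt hSne (by linarith : sInf S < sInf S + η)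
    have hτge : sInf S ≤ τ := csInf_le hSbdd hτS
    have hτne : τ ≠ sInf S := fun h' => hcase (h' ▸ hτS.2)
    exact ⟨τ, ⟨lt_of_le_of_ne hτge (Ne.symm hτne), hτlt⟩, hτS.2⟩

end LiSinai

open LiSinai

/-- **Infinite energy at one time gives the energy profile of `LiSinaiSeriesEnergyBlowup`, up to
right accumulation.** From `LiSinaiSeriesEnergyInfinite` (an admissible datum whose series
solution has infinite energy at some `t > 0`): EITHER `LiSinaiSeriesEnergyBlowup` holds — with
the same datum and blow-up time the first singular time `t₁ ∈ (0, t]`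
(`LiSinai.exists_firstSingularTime`) — OR there is an admissible datum whose series solution has
finite energy on a closed interval `[0, t₁]`, `t₁ > 0`, while every interval `(t₁, t₁ + η)`
contains a time of infinite energy. The second disjunct is what the informal "for `t' < t` …
finite" of §10 p. 312 has to exclude for the critical datum; it is the series-level form of
`LiSinaiCriticalEnergyBlowupNarrow.literal_or_rightAccumulation`. [folklore] -/
theorem LiSinaiSeriesEnergyInfinite.seriesEnergyBlowup_or_rightAccumulation
    (h : LiSinaiSeriesEnergyInfinite) :
    LiSinaiSeriesEnergyBlowup ∨
      ∃ (v₀ : EuclideanSpace ℝ (Fin 3) → EuclideanSpace ℝ (Fin 3)) (a R t₁ : ℝ),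
        0 < a ∧ 0 < t₁ ∧
        Measurable v₀ ∧ (∃ M : ℝ, ∀ k, ‖v₀ k‖ ≤ M) ∧ (∀ k, v₀ k ≠ 0 → a ≤ k 2 ∧ ‖k‖ ≤ R) ∧
        (∀ k, ⟪v₀ k, k⟫ = 0) ∧
        (∀ τ ∈ Icc 0 t₁, ∫⁻ k, ‖seriesSolution v₀ τ k‖ₑ ^ 2 < ∞) ∧
        ∀ η : ℝ, 0 < η → ∃ τ ∈ Ioo t₁ (t₁ + η), ∫⁻ k, ‖seriesSolution v₀ τ k‖ₑ ^ 2 = ∞ := by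
  obtain ⟨v₀, a, R, t, ha, ht, hm, ⟨M₀, hM₀⟩, hsupp, hdiv, hinf⟩ := h
  obtain ⟨t₁, ht₁, -, -, hfin, hcase⟩ := exists_firstSingularTime ha hm hsupp hM₀ ht.le hinf
  rcases hcase with hinf₁ | ⟨hfin₁, hacc⟩
  · exact Or.inl ⟨v₀, a, R, t₁, ha, ht₁, hm, ⟨M₀, hM₀⟩, hsupp, hdiv, hfin, hinf₁⟩
  · refine Or.inr ⟨v₀, a, R, t₁, ha, ht₁, hm, ⟨M₀, hM₀⟩, hsupp, hdiv, ?_, hacc⟩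
    intro τ hτ
    rcases hτ.2.lt_or_eq with hlt | heq
    · exact hfin τ ⟨hτ.1, hlt⟩
    · rw [heq]; exact hfin₁

/-- **`LiSinaiSeriesEnergyBlowup` = a singular time exists and the first one is attained.** The
energy-profile fact holds iff some admissible datum (measurable, bounded, vanishing off
`{a ≤ k₃, |k| ≤ R}` with `a > 0`, incompressible) has a series solution with infinite energy at
some time `t ≥ 0` AND infinite energy at the first such time `inf {τ ≥ 0 : E(τ) = ∞}` (which
is then automatically positive, by `LiSinai.seriesSolution_energy_lt_top`, and preceded by
finite energy). Forward: the blow-up time of the fact is its own first singular time.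
[folklore] -/
theorem LiSinaiSeriesEnergyBlowup_iff_firstSingularTime_attained :
    LiSinaiSeriesEnergyBlowup ↔
      ∃ (v₀ : EuclideanSpace ℝ (Fin 3) → EuclideanSpace ℝ (Fin 3)) (a R : ℝ), 0 < a ∧
        Measurable v₀ ∧ (∃ M : ℝ, ∀ k, ‖v₀ k‖ ≤ M) ∧ (∀ k, v₀ k ≠ 0 → a ≤ k 2 ∧ ‖k‖ ≤ R) ∧
        (∀ k, ⟪v₀ k, k⟫ = 0) ∧
        (∃ t : ℝ, 0 ≤ t ∧ ∫⁻ k, ‖seriesSolution v₀ t k‖ₑ ^ 2 = ∞) ∧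
        ∫⁻ k, ‖seriesSolution v₀
          (sInf {τ : ℝ | 0 ≤ τ ∧ ∫⁻ k, ‖seriesSolution v₀ τ k‖ₑ ^ 2 = ∞}) k‖ₑ ^ 2 = ∞ := by
  classical
  constructor
  · rintro ⟨v₀, a, R, t, ha, ht, hm, hM, hsupp, hdiv, hfin, hinf⟩
    refine ⟨v₀, a, R, ha, hm, hM, hsupp, hdiv, ⟨t, ht.le, hinf⟩, ?_⟩
    set S : Set ℝ := {τ : ℝ | 0 ≤ τ ∧ ∫⁻ k, ‖seriesSolution v₀ τ k‖ₑ ^ 2 = ∞} with hS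
    have htS : t ∈ S := ⟨ht.le, hinf⟩
    have hSbdd : BddBelow S := ⟨0, fun τ hτ => hτ.1⟩
    have hge : ∀ τ ∈ S, t ≤ τ := by
      intro τ hτ
      by_contra hlt
      exact (hfin τ ⟨hτ.1, not_le.1 hlt⟩).ne hτ.2
    have heq : sInf S = t := le_antisymm (csInf_le hSbdd htS) (le_csInf ⟨t, htS⟩ hge)
    rw [heq]
    exact hinf
  · rintro ⟨v₀, a, R, ha, hm, ⟨M₀, hM₀⟩, hsupp, hdiv, ⟨t, ht, hinf⟩, hattained⟩
    obtain ⟨t₁, ht₁, -, ht₁eq, hfin, -⟩ := exists_firstSingularTime ha hm hsupp hM₀ ht hinf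
    refine ⟨v₀, a, R, t₁, ha, ht₁, hm, ⟨M₀, hM₀⟩, hsupp, hdiv, hfin, ?_⟩
    rw [ht₁eq]
    exact hattained

/-! ### The §10 mechanism: geometric decay of the modes gives finite energy (appended) -/

namespace LiSinai

/-- Scaling of the ball volume: `vol B(0, ρ) = ρ³ · vol B(0, 1)` for `ρ ≥ 0` (Haar scaling,
`finrank ℝ ℝ³ = 3`). [folklore] -/
theorem ballVol_eq_pow_mul {ρ : ℝ} (hρ : 0 ≤ ρ) : ballVol ρ = ρ ^ 3 * ballVol 1 := by
  unfold ballVol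
  rw [Measure.addHaar_real_closedBall' volume (0 : EuclideanSpace ℝ (Fin 3)) hρ,
    finrank_euclideanSpace_fin]

/-- **Geometric decay of the modes at time `τ` gives finite energy at `τ`** — the mechanism of the
informal "for `t' < t` … finite" of §10 p. 312 ("for `p ≫ O(1/Δt)` the product
`A_cr Λ(t')^p` tends exponentially to zero and dominates the other terms"), made honest for the
explicit series: if `‖mode v₀ p (τ, k)‖ ≤ C q^p` for all `p, k` with `0 ≤ q < 1`, then, since
`mode v₀ p (τ, ·)` vanishes off `B(0, p|R|)` (`mode_support`), `‖v(τ)‖_∞ ≤ C/(1-q)` and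
`‖v(τ)‖₁ ≤ C vol B(0,1) |R|³ Σ_p p³ q^p < ∞`, so `∫ |v(k,τ)|² dk ≤ ‖v‖_∞ ‖v‖₁ < ∞`. No sign or
time condition on `τ` is needed. [cite: LiSinai2008, §10 p. 312] -/
theorem energy_lt_top_of_mode_geometric {v₀ : EuclideanSpace ℝ (Fin 3) → EuclideanSpace ℝ (Fin 3)}
    {a R : ℝ} (ha : 0 < a) (hv₀m : Measurable v₀) (hv₀ : ∀ k, v₀ k ≠ 0 → a ≤ k 2 ∧ ‖k‖ ≤ R)
    {τ C q : ℝ} (hq0 : 0 ≤ q) (hq1 : q < 1) (hC : ∀ p k, ‖mode v₀ p τ k‖ ≤ C * q ^ p) :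
    ∫⁻ k, ‖seriesSolution v₀ τ k‖ₑ ^ 2 < ∞ := by
  have hC0 : 0 ≤ C := by simpa [mode_zero] using hC 0 0
  have hqn : ‖q‖ < 1 := by rwa [Real.norm_eq_abs, abs_of_nonneg hq0]
  -- pointwise: the series is dominated by the sum of the mode norms
  have hsum_pt : ∀ k, ‖seriesSolution v₀ τ k‖ₑ ≤ ∑' p, ‖mode v₀ p τ k‖ₑ := by
    intro k
    rw [seriesSolution_eq_sum ha hv₀ (lt_floor_succ_mul ha (k 2)) τ]
    exact (enorm_sum_le _ _).trans (ENNReal.sum_le_tsum _)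
  -- each mode is dominated by `C q^p` times the indicator of `B(0, p|R|)`
  have hind : ∀ p k, ‖mode v₀ p τ k‖ₑ ≤ (Metric.closedBall (0 : EuclideanSpace ℝ (Fin 3))
      ((p : ℝ) * |R|)).indicator (fun _ => ENNReal.ofReal (C * q ^ p)) k := by
    intro p k
    by_cases hk : mode v₀ p τ k = 0
    · simp [hk]
    · have hmem : k ∈ Metric.closedBall (0 : EuclideanSpace ℝ (Fin 3)) ((p : ℝ) * |R|) := by
        rw [mem_closedBall_zero_iff]
        exact (mode_support hv₀ p τ k hk).2.trans
          (mul_le_mul_of_nonneg_left (le_abs_self R) (by positivity))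
      rw [Set.indicator_of_mem hmem, ← ofReal_norm]
      exact ENNReal.ofReal_le_ofReal (hC p k)
  -- sup bound
  set S : ℝ≥0∞ := ∑' p : ℕ, ENNReal.ofReal (C * q ^ p) with hS
  have hStop : S < ∞ := by
    rw [hS, ← ENNReal.ofReal_tsum_of_nonneg (fun p => by positivity)
      ((summable_geometric_of_lt_one hq0 hq1).mul_left C)]
    exact ENNReal.ofReal_lt_top
  have hsup : ∀ k, ‖seriesSolution v₀ τ k‖ₑ ≤ S := by
    intro k
    refine (hsum_pt k).trans (ENNReal.tsum_le_tsum fun p => (hind p k).trans ?_)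
    exact Set.indicator_le_self' (fun _ _ => zero_le) k
  -- `L¹` bound
  set T : ℝ≥0∞ := ∑' p : ℕ, ENNReal.ofReal (C * q ^ p) *
    volume (Metric.closedBall (0 : EuclideanSpace ℝ (Fin 3)) ((p : ℝ) * |R|)) with hT
  have hTtop : T < ∞ := by
    have hterm : ∀ p : ℕ, ENNReal.ofReal (C * q ^ p) *
        volume (Metric.closedBall (0 : EuclideanSpace ℝ (Fin 3)) ((p : ℝ) * |R|)) =
        ENNReal.ofReal (C * |R| ^ 3 * ballVol 1 * ((p : ℝ) ^ 3 * q ^ p)) := by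
      intro p
      have hp : 0 ≤ (p : ℝ) * |R| := by positivity
      rw [volume_closedBall_eq_ofReal_ballVol, ballVol_eq_pow_mul hp,
        ← ENNReal.ofReal_mul (by positivity)]
      congr 1
      ring
    have hsum : Summable fun p : ℕ => C * |R| ^ 3 * ballVol 1 * ((p : ℝ) ^ 3 * q ^ p) :=
      (summable_pow_mul_geometric_of_norm_lt_one 3 hqn).mul_left _
    rw [hT, tsum_congr hterm, ← ENNReal.ofReal_tsum_of_nonneg (fun p => ?_) hsum]
    · exact ENNReal.ofReal_lt_top
    · have := ballVol_nonneg 1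
      positivity
  have hL1 : ∫⁻ k, ‖seriesSolution v₀ τ k‖ₑ ≤ T := by
    calc ∫⁻ k, ‖seriesSolution v₀ τ k‖ₑ ≤ ∫⁻ k, ∑' p, ‖mode v₀ p τ k‖ₑ := lintegral_mono hsum_pt
      _ = ∑' p, ∫⁻ k, ‖mode v₀ p τ k‖ₑ :=
          lintegral_tsum fun p => (measurable_mode_slice hv₀m p τ).enorm.aemeasurable
      _ ≤ T := by
          refine ENNReal.tsum_le_tsum fun p => ?_
          calc ∫⁻ k, ‖mode v₀ p τ k‖ₑ
              ≤ ∫⁻ k, (Metric.closedBall (0 : EuclideanSpace ℝ (Fin 3)) ((p : ℝ) * |R|)).indicator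
                  (fun _ => ENNReal.ofReal (C * q ^ p)) k := lintegral_mono (hind p)
            _ = ENNReal.ofReal (C * q ^ p) *
                  volume (Metric.closedBall (0 : EuclideanSpace ℝ (Fin 3)) ((p : ℝ) * |R|)) :=
                lintegral_indicator_const measurableSet_closedBall _
  -- energy `≤ ‖v‖_∞ ‖v‖₁`
  calc ∫⁻ k, ‖seriesSolution v₀ τ k‖ₑ ^ 2
      = ∫⁻ k, ‖seriesSolution v₀ τ k‖ₑ * ‖seriesSolution v₀ τ k‖ₑ := by simp_rw [sq]
    _ ≤ ∫⁻ k, S * ‖seriesSolution v₀ τ k‖ₑ := lintegral_mono fun k => mul_le_mul_left (hsup k) _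
    _ = S * ∫⁻ k, ‖seriesSolution v₀ τ k‖ₑ := lintegral_const_mul' S _ hStop.ne
    _ ≤ S * T := mul_le_mul_right hL1 S
    _ < ∞ := ENNReal.mul_lt_top hStop hTtop

end LiSinai

/-- **The §10 mechanism as a sufficient condition for the energy-profile fact.** If some
admissible datum has a series solution with infinite energy at a time `t > 0` and, at every
earlier time `τ ∈ [0, t)`, geometrically decaying modes `‖mode v₀ p (τ, ·)‖_∞ ≤ C_τ q_τ^p`,
`0 ≤ q_τ < 1` (what §10 p. 312 asserts for the critical datum: "for `p ≫ O(1/Δt)` the product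
`A_cr Λ(t')^p` tends exponentially to zero and dominates the other terms in the expression for
`g_p`"), then `LiSinaiSeriesEnergyBlowup` holds, by `LiSinai.energy_lt_top_of_mode_geometric`.
This is the printed route to the attainment of the first singular time; the mode decay itself
is not proved here (nor stated by Theorem 1 for off-critical times, see the audit in
`ComplexNavierStokesBlowupProofs.lean`). [cite: LiSinai2008, §10 p. 312] -/
theorem LiSinaiSeriesEnergyBlowup.of_infinite_of_modeDecay
    (h : ∃ (v₀ : EuclideanSpace ℝ (Fin 3) → EuclideanSpace ℝ (Fin 3)) (a R t : ℝ),
      0 < a ∧ 0 < t ∧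
      Measurable v₀ ∧ (∃ M : ℝ, ∀ k, ‖v₀ k‖ ≤ M) ∧ (∀ k, v₀ k ≠ 0 → a ≤ k 2 ∧ ‖k‖ ≤ R) ∧
      (∀ k, ⟪v₀ k, k⟫ = 0) ∧
      (∀ τ ∈ Ico 0 t, ∃ C q : ℝ, 0 ≤ q ∧ q < 1 ∧ ∀ p k, ‖mode v₀ p τ k‖ ≤ C * q ^ p) ∧
      ∫⁻ k, ‖seriesSolution v₀ t k‖ₑ ^ 2 = ∞) :
    LiSinaiSeriesEnergyBlowup := by
  obtain ⟨v₀, a, R, t, ha, ht, hm, hM, hsupp, hdiv, hdecay, hinf⟩ := h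
  refine ⟨v₀, a, R, t, ha, ht, hm, hM, hsupp, hdiv, fun τ hτ => ?_, hinf⟩
  obtain ⟨C, q, hq0, hq1, hC⟩ := hdecay τ hτ
  exact energy_lt_top_of_mode_geometric ha hm hsupp hq0 hq1 hC

end Literature.Barriers.NavierStokesRegularity
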